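import Mathlib.Combinatorics.Enumerative.DoubleCounting
import Summits.Ventures.Crystal3D.Theorems.StickyWulffConstantTextureLiminfHcpRunEnd
import HarnessLib

/-!
# The run-end ledger of lane T: charging model M in the kernel (floor `2/(s+2)`, variants (a) and (c))
# (route `StickyWulffConstant`; helper for the crux `TextureLiminf`, cf-p1 ROUTE §84(5)(j), §85(3)(xxvii), (xxx); ask R41s)

HONEST FRAMING. Part of the venture `Summits/Ventures/Crystal3D` (cell `crystal3d-full`), helper for the crux
`TextureLiminf` (stmt-Ventures-19483) of `route-Ventures-StickyWulffConstant`.  Rung credit only: this is the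
BOOKKEEPING step «floor_M(s_T) = 2/(s_T + 2)» adopted by the planner (INBOX 2026-08-28T06:20:45Z) as a
kernel theorem, so that the ONLY named input of the hcp run-end count beyond `KissingGap δ` /
`KissingClassification δ` is the SHARING CONSTANT `s` (lit's census quantity `s_T`, R41p(ii) unit `U_T`),
entering through the hypothesis `hshare` BY NAME — exactly as `hshare k` enters lane F's `…_share`.

SETTING (the exact-lattice convention of `hcpRunEnd_two_unsaturated`, (L7); NO new definitions — `deg`
and the payer set `P` enter as variables pinned by the hypotheses `hdeg`, `hP`): `X` a finite
`1`-separated configuration; `deg z = #{q ∈ X : dist z q = 1}`; `E ⊆ X` a set of hcp RUN-ENDS — every `t ∈ E` has, in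
SOME frame `A` (per run-end: the two layer parities of an hcp grain need different frames), its in-plane
predecessor `t + A·slotSite 2` (hex180), the in-plane neighbour `t + A·slotSite 6` (hex120), the upper
neighbour `t + A·slotSite 8` (tri150↑) and the lower glide site `t + A·u↓` in `X`, and the forward slot
`t + A·slotSite 1` (hex0) EMPTY.  PAYERS `P` = the unsaturated balls (`deg ≤ 11`) that are run-ends
themselves or touch a SATURATED run-end.  (L7) says every saturated run-end touches two distinct payers;
`hshare s` says a payer touches at most `s` saturated run-ends.

RESULTS (all `ℕ`-valued cardinality inequalities; `12 − deg z ≥ 1` on `P`):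
* `abstract_ledger_two_mul_card_le` etc. — the three double-counting lemmas over an arbitrary type (ends
  `E`, payers `P`, relation `r`): model M `2·#E ≤ (s+2)·#P`; variant (a) (payers of saturated ends are not
  ends) `2·#E ≤ 2·#(P ∖ shared) + s·#shared`, hence `#E ≤ #P` for `s ≤ 2`; variant (c) (shared payers weigh
  `≥ 2`) `#E ≤ Σ_P w` for `s ≤ 2`.
* `hcpRunEnd_ledger_floor` — **model M**: `2·#E ≤ (s+2)·#P ≤ (s+2)·Σ_{z ∈ P} (12 − deg z)`
  (`u_T = 2/(s+2)`: `s = 0 ↦ 1`, `1 ↦ ⅔`, `2 ↦ ½`).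
* `hcpRunEnd_ledger_variantA` — **variant (a)**: if no unsaturated ball touching a saturated run-end is
  itself a run-end and `s ≤ 2`, then `#E ≤ #P ≤ Σ_{z ∈ P} (12 − deg z)` (`u_T = 1`).
* `hcpRunEnd_ledger_variantC` — **(c)-lift**: if every unsaturated ball touching a saturated run-end has
  `deg ≤ 10` and `s ≤ 2`, then `#E ≤ Σ_{z ∈ P} (12 − deg z)` (`u_T = 1`).
By (xxx) the texture needs `u_T ≥ 0.975`, i.e. one of the last two regimes (or `s = 0`); which regime the
hcp wall realises is the census question (lit j302744, unit LT), not settled here.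

WHAT THIS IS NOT: not a bound on `s` (that is the census / a future certificate); not the stub of any crux;
no statement about which balls of a texture cell are run-ends (the localisation is `stub_textureBuild`'s);
F-C1 not moved.
-/

noncomputable section

namespace Summit.Ventures.Crystal3D.Theorems

open Summit.Ventures.Crystal3D Finset
open scoped InnerProductSpace

/-! ### Abstract double counting (model M and its two variants) -/

section Abstract

variable {α : Type*} [DecidableEq α] (E P : Finset α) (r : α → α → Prop) [∀ a b, Decidable (r a b)]

/-- **Model M, abstract.**  Ends `E`, payers `P`, a relation `r` («touches»).  If every end that is not a
payer is `r`-related to at least two payers, and every payer is `r`-related to at most `s` ends that are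
not payers, then `2·#E ≤ (s+2)·#P`. -/
theorem abstract_ledger_two_mul_card_le (s : ℕ)
    (htwo : ∀ e ∈ E \ P, 2 ≤ (P.filter fun p => r e p).card)
    (hshare : ∀ p ∈ P, ((E \ P).filter fun e => r e p).card ≤ s) :
    2 * E.card ≤ (s + 2) * P.card := by
  have hsplit : E.card = (E ∩ P).card + (E \ P).card := (Finset.card_inter_add_card_sdiff E P).symm
  have h1 : (E ∩ P).card ≤ P.card := Finset.card_le_card Finset.inter_subset_right
  have h2 : (E \ P).card * 2 ≤ P.card * s :=
    Finset.card_mul_le_card_mul (r := r) (fun e he => htwo e he) (fun p hp => hshare p hp)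
  nlinarith

/-- **Variant (a), abstract.**  If, in addition, no payer `r`-related to a non-payer end is itself an end,
then with `P₂` = the payers related to some non-payer end («shared payers»):
`2·#E ≤ 2·#(P ∖ P₂) + s·#P₂`. -/
theorem abstract_ledger_variantA (s : ℕ)
    (htwo : ∀ e ∈ E \ P, 2 ≤ (P.filter fun p => r e p).card)
    (hshare : ∀ p ∈ P, ((E \ P).filter fun e => r e p).card ≤ s)
    (hnotEnd : ∀ p ∈ P, ∀ e ∈ E \ P, r e p → p ∉ E) :
    2 * E.card ≤ 2 * (P \ P.filter fun p => ∃ e ∈ E \ P, r e p).card +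
      s * (P.filter fun p => ∃ e ∈ E \ P, r e p).card := by
  set P₂ := P.filter fun p => ∃ e ∈ E \ P, r e p with hP₂
  have hsplit : E.card = (E ∩ P).card + (E \ P).card := (Finset.card_inter_add_card_sdiff E P).symm
  -- ends that are payers avoid the shared payers
  have h1 : (E ∩ P).card ≤ (P \ P₂).card := by
    apply Finset.card_le_card
    intro p hp
    obtain ⟨hpE, hpP⟩ := Finset.mem_inter.mp hp
    refine Finset.mem_sdiff.mpr ⟨hpP, fun hp2 => ?_⟩
    obtain ⟨-, e, he, hre⟩ := Finset.mem_filter.mp hp2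
    exact hnotEnd p hpP e he hre hpE
  -- every payer of a non-payer end is shared
  have htwo' : ∀ e ∈ E \ P, 2 ≤ (P₂.filter fun p => r e p).card := by
    intro e he
    refine le_trans (htwo e he) (Finset.card_le_card ?_)
    intro p hp
    obtain ⟨hpP, hre⟩ := Finset.mem_filter.mp hp
    exact Finset.mem_filter.mpr ⟨Finset.mem_filter.mpr ⟨hpP, e, he, hre⟩, hre⟩
  have hshare' : ∀ p ∈ P₂, ((E \ P).filter fun e => r e p).card ≤ s :=
    fun p hp => hshare p (Finset.mem_filter.mp hp).1
  have h2 : (E \ P).card * 2 ≤ P₂.card * s :=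
    Finset.card_mul_le_card_mul (r := r) htwo' hshare'
  nlinarith

/-- Variant (a) at sharing `s ≤ 2`: `#E ≤ #P` (full charge). -/
theorem abstract_ledger_variantA_le_two {s : ℕ} (hs : s ≤ 2)
    (htwo : ∀ e ∈ E \ P, 2 ≤ (P.filter fun p => r e p).card)
    (hshare : ∀ p ∈ P, ((E \ P).filter fun e => r e p).card ≤ s)
    (hnotEnd : ∀ p ∈ P, ∀ e ∈ E \ P, r e p → p ∉ E) :
    E.card ≤ P.card := by
  have h := abstract_ledger_variantA E P r s htwo hshare hnotEnd
  have hsub : (P.filter fun p => ∃ e ∈ E \ P, r e p) ⊆ P := Finset.filter_subset _ _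
  have hsplit : (P \ P.filter fun p => ∃ e ∈ E \ P, r e p).card +
      (P.filter fun p => ∃ e ∈ E \ P, r e p).card = P.card :=
    Finset.card_sdiff_add_card_eq_card hsub
  have h3 : s * (P.filter fun p => ∃ e ∈ E \ P, r e p).card ≤
      2 * (P.filter fun p => ∃ e ∈ E \ P, r e p).card := Nat.mul_le_mul_right _ hs
  omega

/-- **Variant (c), abstract (deficiency lift).**  With a weight `w ≥ 1` on payers and `w ≥ 2` on the
shared payers (those related to a non-payer end), at sharing `s ≤ 2`: `#E ≤ Σ_{p ∈ P} w p`. -/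
theorem abstract_ledger_variantC {s : ℕ} (hs : s ≤ 2) (w : α → ℕ)
    (htwo : ∀ e ∈ E \ P, 2 ≤ (P.filter fun p => r e p).card)
    (hshare : ∀ p ∈ P, ((E \ P).filter fun e => r e p).card ≤ s)
    (hw1 : ∀ p ∈ P, 1 ≤ w p) (hw2 : ∀ p ∈ P, ∀ e ∈ E \ P, r e p → 2 ≤ w p) :
    E.card ≤ ∑ p ∈ P, w p := by
  set P₂ := P.filter fun p => ∃ e ∈ E \ P, r e p with hP₂
  have hsub : P₂ ⊆ P := Finset.filter_subset _ _
  have hsplit : E.card = (E ∩ P).card + (E \ P).card := (Finset.card_inter_add_card_sdiff E P).symm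
  have h1 : (E ∩ P).card ≤ P.card := Finset.card_le_card Finset.inter_subset_right
  have hP : (P \ P₂).card + P₂.card = P.card := Finset.card_sdiff_add_card_eq_card hsub
  have htwo' : ∀ e ∈ E \ P, 2 ≤ (P₂.filter fun p => r e p).card := by
    intro e he
    refine le_trans (htwo e he) (Finset.card_le_card ?_)
    intro p hp
    obtain ⟨hpP, hre⟩ := Finset.mem_filter.mp hp
    exact Finset.mem_filter.mpr ⟨Finset.mem_filter.mpr ⟨hpP, e, he, hre⟩, hre⟩
  have hshare' : ∀ p ∈ P₂, ((E \ P).filter fun e => r e p).card ≤ s :=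
    fun p hp => hshare p (Finset.mem_filter.mp hp).1
  have h2 : (E \ P).card * 2 ≤ P₂.card * s :=
    Finset.card_mul_le_card_mul (r := r) htwo' hshare'
  -- weights: `Σ_P w = Σ_{P \ P₂} w + Σ_{P₂} w ≥ #(P \ P₂) + 2 #P₂`
  have hsum : ∑ p ∈ P, w p = ∑ p ∈ P \ P₂, w p + ∑ p ∈ P₂, w p :=
    (Finset.sum_sdiff hsub).symm
  have hs1 : (P \ P₂).card ≤ ∑ p ∈ P \ P₂, w p := by
    rw [Finset.card_eq_sum_ones]
    exact Finset.sum_le_sum fun p hp => hw1 p (Finset.mem_sdiff.mp hp).1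
  have hs2 : 2 * P₂.card ≤ ∑ p ∈ P₂, w p := by
    rw [Finset.card_eq_sum_ones, Finset.mul_sum]
    refine Finset.sum_le_sum fun p hp => ?_
    obtain ⟨hpP, e, he, hre⟩ := Finset.mem_filter.mp hp
    simpa using hw2 p hpP e he hre
  have h3 : P₂.card * s ≤ P₂.card * 2 := Nat.mul_le_mul_left _ hs
  omega

end Abstract

/-! ### The hcp run-end ledger -/

/-! No new definitions are introduced (pure-proof file): the contact number enters as a function `deg`
with the hypothesis `hdeg : ∀ z, deg z = #{q ∈ X : dist z q = 1}`, the payer set as `P` with `hP`, and the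
run-end property is spelled out in `hrun` (the glide site `u↓` written as in `…HcpRunEnd`). -/

variable {X : Finset (EuclideanSpace ℝ (Fin 3))}

/-- A run-end of `E ⊆ X` that is not a payer is saturated. -/
theorem deg_eq_twelve_of_mem_sdiff_payers
    (hX : ∀ p ∈ X, ∀ q ∈ X, p ≠ q → 1 ≤ dist p q) {deg : EuclideanSpace ℝ (Fin 3) → ℕ}
    (hdeg : ∀ z, deg z = (X.filter fun q => dist z q = 1).card)
    {E P : Finset (EuclideanSpace ℝ (Fin 3))} (hEX : E ⊆ X)
    (hP : P = X.filter fun z => deg z ≤ 11 ∧ (z ∈ E ∨ ∃ t ∈ E, deg t = 12 ∧ dist t z = 1))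
    {t : EuclideanSpace ℝ (Fin 3)} (ht : t ∈ E \ P) : deg t = 12 := by
  obtain ⟨htE, htP⟩ := Finset.mem_sdiff.mp ht
  have hle : deg t ≤ 12 := by rw [hdeg]; exact card_filter_dist_eq_one_le_twelve X hX t
  by_contra hne
  apply htP
  rw [hP]
  exact Finset.mem_filter.mpr ⟨hEX htE, by omega, Or.inl htE⟩

/-- (L7) in ledger form: a saturated hcp run-end `t ∈ E` (predecessor hex180, neighbours hex120, tri150↑,
tri150↓ present in the frame `A`, forward slot hex0 empty) touches at least two payers. -/
theorem two_le_card_payers_of_saturated_runEnd {δ : ℝ} (hg : KissingGap δ) (hc : KissingClassification δ)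
    (hX : ∀ p ∈ X, ∀ q ∈ X, p ≠ q → 1 ≤ dist p q) {deg : EuclideanSpace ℝ (Fin 3) → ℕ}
    (hdeg : ∀ z, deg z = (X.filter fun q => dist z q = 1).card)
    {E P : Finset (EuclideanSpace ℝ (Fin 3))}
    (hP : P = X.filter fun z => deg z ≤ 11 ∧ (z ∈ E ∨ ∃ t ∈ E, deg t = 12 ∧ dist t z = 1))
    {t : EuclideanSpace ℝ (Fin 3)} (htE : t ∈ E) (A : EuclideanSpace ℝ (Fin 3) ≃ₗᵢ[ℝ] EuclideanSpace ℝ (Fin 3))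
    (haX : t + A (slotSite 2) ∈ X) (hbX : t + A (slotSite 6) ∈ X) (hcX : t + A (slotSite 8) ∈ X)
    (hdX : t + A ((1 / 3 : ℝ) • slotSite 8 - (2 / 3 : ℝ) • slotSite 0 - (2 / 3 : ℝ) • slotSite 4) ∈ X)
    (hemp : t + A (slotSite 1) ∉ X) (h12 : deg t = 12) :
    2 ≤ (P.filter fun z => dist t z = 1).card := by
  have h12' : (X.filter fun q => dist t q = 1).card = 12 := by rw [← hdeg]; exact h12
  obtain ⟨z, hz, z', hz', hne, hdz, hdz', hcz, hcz'⟩ :=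
    hcpRunEnd_two_unsaturated hg hc hX h12' A haX hbX hcX hdX hemp
  have hzP : z ∈ P.filter fun q => dist t q = 1 := by
    rw [hP]
    exact Finset.mem_filter.mpr
      ⟨Finset.mem_filter.mpr ⟨hz, by rw [hdeg]; exact hcz, Or.inr ⟨t, htE, h12, hdz⟩⟩, hdz⟩
  have hz'P : z' ∈ P.filter fun q => dist t q = 1 := by
    rw [hP]
    exact Finset.mem_filter.mpr
      ⟨Finset.mem_filter.mpr ⟨hz', by rw [hdeg]; exact hcz', Or.inr ⟨t, htE, h12, hdz'⟩⟩, hdz'⟩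
  have hsub : ({z, z'} : Finset _) ⊆ P.filter fun q => dist t q = 1 := by
    intro q hq
    rcases Finset.mem_insert.mp hq with rfl | hq
    · exact hzP
    · rw [Finset.mem_singleton.mp hq]; exact hz'P
  calc 2 = ({z, z'} : Finset _).card := (Finset.card_pair hne).symm
    _ ≤ _ := Finset.card_le_card hsub

/-- Each payer carries at least one unit of deficiency: `#P ≤ Σ_{z ∈ P} (12 − deg z)`. -/
theorem card_payers_le_sum_deficiency {deg : EuclideanSpace ℝ (Fin 3) → ℕ}
    {E P : Finset (EuclideanSpace ℝ (Fin 3))}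
    (hP : P = X.filter fun z => deg z ≤ 11 ∧ (z ∈ E ∨ ∃ t ∈ E, deg t = 12 ∧ dist t z = 1)) :
    P.card ≤ ∑ z ∈ P, (12 - deg z) := by
  rw [Finset.card_eq_sum_ones]
  refine Finset.sum_le_sum fun z hz => ?_
  rw [hP] at hz
  have := (Finset.mem_filter.mp hz).2.1
  omega

/-- **THE RUN-END LEDGER, MODEL M** (`u_T = 2/(s+2)`).  `X` `1`-separated; `E ⊆ X` a set of hcp run-ends
(each with its own frame `A`); `P` the payers (unsaturated balls that are run-ends of `E` or touch a
saturated run-end of `E`); SHARING HYPOTHESIS `hshare s`: every unsaturated ball touches at most `s`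
saturated run-ends of `E`.  Then `2·#E ≤ (s+2)·#P`, modulo `KissingGap δ`, `KissingClassification δ`
(through (L7)). -/
theorem hcpRunEnd_ledger_floor {δ : ℝ} (hg : KissingGap δ) (hc : KissingClassification δ)
    (hX : ∀ p ∈ X, ∀ q ∈ X, p ≠ q → 1 ≤ dist p q) {deg : EuclideanSpace ℝ (Fin 3) → ℕ}
    (hdeg : ∀ z, deg z = (X.filter fun q => dist z q = 1).card)
    {E P : Finset (EuclideanSpace ℝ (Fin 3))} (hEX : E ⊆ X)
    (hrun : ∀ t ∈ E, ∃ A : EuclideanSpace ℝ (Fin 3) ≃ₗᵢ[ℝ] EuclideanSpace ℝ (Fin 3),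
      t + A (slotSite 2) ∈ X ∧ t + A (slotSite 6) ∈ X ∧ t + A (slotSite 8) ∈ X ∧
      t + A ((1 / 3 : ℝ) • slotSite 8 - (2 / 3 : ℝ) • slotSite 0 - (2 / 3 : ℝ) • slotSite 4) ∈ X ∧
      t + A (slotSite 1) ∉ X)
    (hP : P = X.filter fun z => deg z ≤ 11 ∧ (z ∈ E ∨ ∃ t ∈ E, deg t = 12 ∧ dist t z = 1))
    (s : ℕ) (hshare : ∀ z ∈ X, deg z ≤ 11 → (E.filter fun t => deg t = 12 ∧ dist t z = 1).card ≤ s) :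
    2 * E.card ≤ (s + 2) * P.card := by
  refine abstract_ledger_two_mul_card_le E P (fun t z => dist t z = 1) s ?_ ?_
  · intro t ht
    obtain ⟨A, haX, hbX, hcX, hdX, hemp⟩ := hrun t (Finset.mem_sdiff.mp ht).1
    exact two_le_card_payers_of_saturated_runEnd hg hc hX hdeg hP (Finset.mem_sdiff.mp ht).1 A haX hbX
      hcX hdX hemp (deg_eq_twelve_of_mem_sdiff_payers hX hdeg hEX hP ht)
  · intro z hz
    have hz' := hz
    rw [hP] at hz'
    obtain ⟨hzX, hdg, -⟩ := Finset.mem_filter.mp hz'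
    refine le_trans (Finset.card_le_card fun t ht => ?_) (hshare z hzX hdg)
    obtain ⟨ht, hd⟩ := Finset.mem_filter.mp ht
    exact Finset.mem_filter.mpr
      ⟨(Finset.mem_sdiff.mp ht).1, deg_eq_twelve_of_mem_sdiff_payers hX hdeg hEX hP ht, hd⟩

/-- Model M in deficiency currency: `2·#E ≤ (s+2)·Σ_{z ∈ P} (12 − deg z)`. -/
theorem hcpRunEnd_ledger_floor_deficiency {δ : ℝ} (hg : KissingGap δ) (hc : KissingClassification δ)
    (hX : ∀ p ∈ X, ∀ q ∈ X, p ≠ q → 1 ≤ dist p q) {deg : EuclideanSpace ℝ (Fin 3) → ℕ}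
    (hdeg : ∀ z, deg z = (X.filter fun q => dist z q = 1).card)
    {E P : Finset (EuclideanSpace ℝ (Fin 3))} (hEX : E ⊆ X)
    (hrun : ∀ t ∈ E, ∃ A : EuclideanSpace ℝ (Fin 3) ≃ₗᵢ[ℝ] EuclideanSpace ℝ (Fin 3),
      t + A (slotSite 2) ∈ X ∧ t + A (slotSite 6) ∈ X ∧ t + A (slotSite 8) ∈ X ∧
      t + A ((1 / 3 : ℝ) • slotSite 8 - (2 / 3 : ℝ) • slotSite 0 - (2 / 3 : ℝ) • slotSite 4) ∈ X ∧
      t + A (slotSite 1) ∉ X)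
    (hP : P = X.filter fun z => deg z ≤ 11 ∧ (z ∈ E ∨ ∃ t ∈ E, deg t = 12 ∧ dist t z = 1))
    (s : ℕ) (hshare : ∀ z ∈ X, deg z ≤ 11 → (E.filter fun t => deg t = 12 ∧ dist t z = 1).card ≤ s) :
    2 * E.card ≤ (s + 2) * ∑ z ∈ P, (12 - deg z) :=
  le_trans (hcpRunEnd_ledger_floor hg hc hX hdeg hEX hrun hP s hshare)
    (Nat.mul_le_mul_left _ (card_payers_le_sum_deficiency hP))

/-- **THE RUN-END LEDGER, VARIANT (a)** (`u_T = 1`): if moreover `s ≤ 2` and no unsaturated ball touching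
a saturated run-end of `E` is itself a run-end of `E` («shared payers are never row-ends», census field
E5), then `#E ≤ #P ≤ Σ_{z ∈ P} (12 − deg z)`. -/
theorem hcpRunEnd_ledger_variantA {δ : ℝ} (hg : KissingGap δ) (hc : KissingClassification δ)
    (hX : ∀ p ∈ X, ∀ q ∈ X, p ≠ q → 1 ≤ dist p q) {deg : EuclideanSpace ℝ (Fin 3) → ℕ}
    (hdeg : ∀ z, deg z = (X.filter fun q => dist z q = 1).card)
    {E P : Finset (EuclideanSpace ℝ (Fin 3))} (hEX : E ⊆ X)
    (hrun : ∀ t ∈ E, ∃ A : EuclideanSpace ℝ (Fin 3) ≃ₗᵢ[ℝ] EuclideanSpace ℝ (Fin 3),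
      t + A (slotSite 2) ∈ X ∧ t + A (slotSite 6) ∈ X ∧ t + A (slotSite 8) ∈ X ∧
      t + A ((1 / 3 : ℝ) • slotSite 8 - (2 / 3 : ℝ) • slotSite 0 - (2 / 3 : ℝ) • slotSite 4) ∈ X ∧
      t + A (slotSite 1) ∉ X)
    (hP : P = X.filter fun z => deg z ≤ 11 ∧ (z ∈ E ∨ ∃ t ∈ E, deg t = 12 ∧ dist t z = 1))
    {s : ℕ} (hs : s ≤ 2)
    (hshare : ∀ z ∈ X, deg z ≤ 11 → (E.filter fun t => deg t = 12 ∧ dist t z = 1).card ≤ s)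
    (hnotEnd : ∀ z ∈ X, deg z ≤ 11 → (∃ t ∈ E, deg t = 12 ∧ dist t z = 1) → z ∉ E) :
    E.card ≤ P.card ∧ P.card ≤ ∑ z ∈ P, (12 - deg z) := by
  refine ⟨abstract_ledger_variantA_le_two E P (fun t z => dist t z = 1) hs ?_ ?_ ?_,
    card_payers_le_sum_deficiency hP⟩
  · intro t ht
    obtain ⟨A, haX, hbX, hcX, hdX, hemp⟩ := hrun t (Finset.mem_sdiff.mp ht).1
    exact two_le_card_payers_of_saturated_runEnd hg hc hX hdeg hP (Finset.mem_sdiff.mp ht).1 A haX hbX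
      hcX hdX hemp (deg_eq_twelve_of_mem_sdiff_payers hX hdeg hEX hP ht)
  · intro z hz
    have hz' := hz
    rw [hP] at hz'
    obtain ⟨hzX, hdg, -⟩ := Finset.mem_filter.mp hz'
    refine le_trans (Finset.card_le_card fun t ht => ?_) (hshare z hzX hdg)
    obtain ⟨ht, hd⟩ := Finset.mem_filter.mp ht
    exact Finset.mem_filter.mpr
      ⟨(Finset.mem_sdiff.mp ht).1, deg_eq_twelve_of_mem_sdiff_payers hX hdeg hEX hP ht, hd⟩
  · intro z hz t ht hd
    have hz' := hz
    rw [hP] at hz'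
    obtain ⟨hzX, hdg, -⟩ := Finset.mem_filter.mp hz'
    exact hnotEnd z hzX hdg
      ⟨t, (Finset.mem_sdiff.mp ht).1, deg_eq_twelve_of_mem_sdiff_payers hX hdeg hEX hP ht, hd⟩

/-- **THE RUN-END LEDGER, VARIANT (c)** (deficiency lift, `u_T = 1`): if `s ≤ 2` and every unsaturated
ball touching a saturated run-end of `E` has at most TEN contacts (deficiency `≥ 2`, census field E4),
then `#E ≤ Σ_{z ∈ P} (12 − deg z)`. -/
theorem hcpRunEnd_ledger_variantC {δ : ℝ} (hg : KissingGap δ) (hc : KissingClassification δ)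
    (hX : ∀ p ∈ X, ∀ q ∈ X, p ≠ q → 1 ≤ dist p q) {deg : EuclideanSpace ℝ (Fin 3) → ℕ}
    (hdeg : ∀ z, deg z = (X.filter fun q => dist z q = 1).card)
    {E P : Finset (EuclideanSpace ℝ (Fin 3))} (hEX : E ⊆ X)
    (hrun : ∀ t ∈ E, ∃ A : EuclideanSpace ℝ (Fin 3) ≃ₗᵢ[ℝ] EuclideanSpace ℝ (Fin 3),
      t + A (slotSite 2) ∈ X ∧ t + A (slotSite 6) ∈ X ∧ t + A (slotSite 8) ∈ X ∧
      t + A ((1 / 3 : ℝ) • slotSite 8 - (2 / 3 : ℝ) • slotSite 0 - (2 / 3 : ℝ) • slotSite 4) ∈ X ∧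
      t + A (slotSite 1) ∉ X)
    (hP : P = X.filter fun z => deg z ≤ 11 ∧ (z ∈ E ∨ ∃ t ∈ E, deg t = 12 ∧ dist t z = 1))
    {s : ℕ} (hs : s ≤ 2)
    (hshare : ∀ z ∈ X, deg z ≤ 11 → (E.filter fun t => deg t = 12 ∧ dist t z = 1).card ≤ s)
    (hten : ∀ z ∈ X, deg z ≤ 11 → (∃ t ∈ E, deg t = 12 ∧ dist t z = 1) → deg z ≤ 10) :
    E.card ≤ ∑ z ∈ P, (12 - deg z) := by
  refine abstract_ledger_variantC E P (fun t z => dist t z = 1) hs (fun z => 12 - deg z) ?_ ?_ ?_ ?_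
  · intro t ht
    obtain ⟨A, haX, hbX, hcX, hdX, hemp⟩ := hrun t (Finset.mem_sdiff.mp ht).1
    exact two_le_card_payers_of_saturated_runEnd hg hc hX hdeg hP (Finset.mem_sdiff.mp ht).1 A haX hbX
      hcX hdX hemp (deg_eq_twelve_of_mem_sdiff_payers hX hdeg hEX hP ht)
  · intro z hz
    have hz' := hz
    rw [hP] at hz'
    obtain ⟨hzX, hdg, -⟩ := Finset.mem_filter.mp hz'
    refine le_trans (Finset.card_le_card fun t ht => ?_) (hshare z hzX hdg)
    obtain ⟨ht, hd⟩ := Finset.mem_filter.mp ht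
    exact Finset.mem_filter.mpr
      ⟨(Finset.mem_sdiff.mp ht).1, deg_eq_twelve_of_mem_sdiff_payers hX hdeg hEX hP ht, hd⟩
  · intro z hz
    rw [hP] at hz
    have := (Finset.mem_filter.mp hz).2.1
    omega
  · intro z hz t ht hd
    have hz' := hz
    rw [hP] at hz'
    obtain ⟨hzX, hdg, -⟩ := Finset.mem_filter.mp hz'
    have := hten z hzX hdg
      ⟨t, (Finset.mem_sdiff.mp ht).1, deg_eq_twelve_of_mem_sdiff_payers hX hdeg hEX hP ht, hd⟩
    omega

end Summit.Ventures.Crystal3D.Theorems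

end
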